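import Literature.Algebra.EuclideanLattices.LatticeUnfoldingSummable
import Literature.Algebra.EuclideanLattices.DualLattice
import Mathlib.Analysis.Fourier.FourierTransform
import Mathlib.Algebra.Module.ZLattice.Summable
import Mathlib.Analysis.Normed.Group.FunctionSeries
import HarnessLib

/-!
# Pointwise Poisson summation over a Euclidean lattice for normally summable periodizations

Topic `Literature/Algebra/EuclideanLattices`, continuing `LatticePeriodicFunctions`,
`LatticeDescentFourier`, `LatticeUnfoldingSummable` (full lattice `L ≤ E`, `fdom L`, `echar L k`,
`mean L μ`). Here `E` is a finite-dimensional real INNER PRODUCT space with its volume, and the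
characters are identified with exponentials of dual vectors:

* `dualVec L k = ∑ᵢ kᵢ bᵢ*` (dual basis of `rBasis L` for the inner product), with
  `⟪dualVec L k, x⟫ = ∑ᵢ kᵢ xᵢ` and `echar L k x = exp (2πi ⟪dualVec L k, x⟫)`; `k ↦ dualVec L k`
  is an injective group homomorphism, its shells are finite and `∑ₖ e^{-c ‖dualVec L k‖} < ∞`;
* **`hasSum_echar_tsum_of_summable`** — POINTWISE POISSON SUMMATION: for `h : E → ℂ` continuous
  and integrable whose lattice translates are normally summable near the fundamental domain and
  whose Fourier transform is absolutely summable over the dual vectors,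
  `∑_{ℓ ∈ L} h (x + ℓ) = (vol fdom)⁻¹ ∑ₖ 𝓕 h (dualVec L k) · echar L k x` for EVERY `x`
  (Mathlib's `UnitAddTorus.hasSum_mFourier_series_apply_of_summable` transported along `descend`,
  with the coefficients computed by unfolding, `mean_echar_mul_tsum_of_summable`, the complex
  analogue of `mean_echar_mul_periodize_of_summable`).

[cite: Grafakos2014, Thm 3.2.8] [cite: SteinWeiss1971, VII §2 Cor 2.6]

## Mathlib / tree search

Tree: `LatticePeriodic.rBasis/fdom/echar/mean/toTorus/descend`, `continuous_descend`,
`descend_toTorus`, `echar_eq_mFourier`, `mFourierCoeff_descend`, `isAddFundamentalDomain`,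
`integrableOn_fdom`, `innerₗ_nondegenerate`. Mathlib: `LinearMap.BilinForm.dualBasis`,
`LinearMap.BilinForm.apply_dualBasis_left`, `Basis.restrictScalars`, `ZSpan.setFinite_inter`,
`ZSpan.fract`, `ZLattice.summable_norm_rpow`, `Real.pow_div_factorial_le_exp`, `continuousOn_tsum`,
`Real.fourier_eq'`, `UnitAddTorus.hasSum_mFourier_series_apply_of_summable`,
`IsAddFundamentalDomain.integral_eq_tsum''`, `integral_tsum_of_summable_integral_norm`.
-/

noncomputable section

open MeasureTheory Module Submodule Filter Topology Complex Finset ZSpan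
open scoped Real FourierTransform RealInnerProductSpace

namespace Literature.Algebra.EuclideanLattices.LatticePeriodic

variable {E : Type*} [NormedAddCommGroup E] [InnerProductSpace ℝ E] [FiniteDimensional ℝ E]
  [MeasurableSpace E] [BorelSpace E]
variable (L : Submodule ℤ E) [DiscreteTopology L] [IsZLattice ℝ L]

/-- The basis `(bᵢ*)` of `E` dual to `rBasis L` for the inner product: `⟪bᵢ*, bⱼ⟫ = δᵢⱼ`.
[folklore] -/
def dualRBasis : Basis (Fin (finrank ℝ E)) ℝ E :=
  LinearMap.BilinForm.dualBasis (innerₗ E : LinearMap.BilinForm ℝ E) innerₗ_nondegenerate (rBasis L)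

/-- The dual vector `∑ᵢ kᵢ bᵢ*` of an integer frequency `k`, where `(bᵢ*)` is the basis of `E` dual
to `rBasis L` for the inner product. [folklore] -/
def dualVec (k : Fin (finrank ℝ E) → ℤ) : E :=
  ∑ i, (k i : ℝ) • (LinearMap.BilinForm.dualBasis (innerₗ E : LinearMap.BilinForm ℝ E)
    innerₗ_nondegenerate (rBasis L)) i

omit [MeasurableSpace E] [BorelSpace E] in
/-- `dualVec L k = ∑ᵢ kᵢ bᵢ*` in terms of `dualRBasis`. [folklore] -/
theorem dualVec_eq_sum (k : Fin (finrank ℝ E) → ℤ) : dualVec L k = ∑ i, (k i : ℝ) • dualRBasis L i :=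
  rfl

omit [MeasurableSpace E] [BorelSpace E] in
/-- `⟪bᵢ*, bⱼ⟫ = δᵢⱼ`. [folklore] -/
theorem inner_dualRBasis_rBasis (i j : Fin (finrank ℝ E)) :
    ⟪dualRBasis L i, rBasis L j⟫ = if j = i then 1 else 0 := by
  rw [← innerₗ_apply_apply, dualRBasis, LinearMap.BilinForm.apply_dualBasis_left]

omit [MeasurableSpace E] [BorelSpace E] in
/-- `⟪bᵢ*, x⟫ = xᵢ`: the dual basis vectors read off the coordinates in `rBasis L`. [folklore] -/
theorem inner_dualRBasis_left (i : Fin (finrank ℝ E)) (x : E) :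
    ⟪dualRBasis L i, x⟫ = (rBasis L).repr x i := by
  have h : (innerₗ E : LinearMap.BilinForm ℝ E) (dualRBasis L i) = (rBasis L).coord i := by
    refine (rBasis L).ext fun j => ?_
    rw [innerₗ_apply_apply, inner_dualRBasis_rBasis, Basis.coord_apply, Basis.repr_self,
      Finsupp.single_apply]
  have h' := LinearMap.congr_fun h x
  rwa [innerₗ_apply_apply, Basis.coord_apply] at h'

omit [MeasurableSpace E] [BorelSpace E] in
/-- `⟪dualVec L k, x⟫ = ∑ᵢ kᵢ xᵢ` (`xᵢ` the coordinates of `x` in `rBasis L`). [folklore] -/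
theorem inner_dualVec (k : Fin (finrank ℝ E) → ℤ) (x : E) :
    ⟪dualVec L k, x⟫ = ∑ i, (k i : ℝ) * (rBasis L).repr x i := by
  simp only [dualVec_eq_sum, sum_inner, real_inner_smul_left, inner_dualRBasis_left]

omit [MeasurableSpace E] [BorelSpace E] in
/-- The characters are exponentials of the dual vectors: `echar L k x = exp (2πi ⟪dualVec L k, x⟫)`.
[folklore] -/
theorem echar_eq_cexp_inner_dualVec (k : Fin (finrank ℝ E) → ℤ) (x : E) :
    echar L k x = Complex.exp (2 * π * Complex.I * (⟪dualVec L k, x⟫ : ℝ)) := by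
  rw [inner_dualVec]
  rfl

omit [MeasurableSpace E] [BorelSpace E] in
/-- `dualVec` is additive. [folklore] -/
theorem dualVec_add (k k' : Fin (finrank ℝ E) → ℤ) : dualVec L (k + k') = dualVec L k + dualVec L k' := by
  simp only [dualVec_eq_sum, Pi.add_apply, Int.cast_add, add_smul, Finset.sum_add_distrib]

omit [MeasurableSpace E] [BorelSpace E] in
/-- `dualVec` is odd. [folklore] -/
theorem dualVec_neg (k : Fin (finrank ℝ E) → ℤ) : dualVec L (-k) = -dualVec L k := by
  simp only [dualVec_eq_sum, Pi.neg_apply, Int.cast_neg, neg_smul, Finset.sum_neg_distrib]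

/-- `k ↦ ∑ᵢ kᵢ bᵢ*` as the coordinate bijection onto the `ℤ`-span of the dual basis. [folklore] -/
private def dualEquiv : (Fin (finrank ℝ E) → ℤ) ≃ span ℤ (Set.range (dualRBasis L)) :=
  (((dualRBasis L).restrictScalars ℤ).equivFun.symm).toEquiv

omit [MeasurableSpace E] [BorelSpace E] in
/-- The coordinate bijection followed by the inclusion is `dualVec L`. [folklore] -/
private theorem coe_dualEquiv (k : Fin (finrank ℝ E) → ℤ) :
    ((dualEquiv L k : span ℤ (Set.range (dualRBasis L))) : E) = dualVec L k := by
  simp only [dualEquiv, LinearEquiv.coe_toEquiv, Basis.equivFun_symm_apply, Submodule.coe_sum,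
    Submodule.coe_smul, Basis.restrictScalars_apply, dualVec_eq_sum]
  exact Finset.sum_congr rfl fun i _ => (Int.cast_smul_eq_zsmul ℝ (k i) _).symm

omit [MeasurableSpace E] [BorelSpace E] in
/-- `dualVec` is injective. [folklore] -/
theorem dualVec_injective : Function.Injective (dualVec L) := by
  intro k k' hkk'
  rw [← coe_dualEquiv, ← coe_dualEquiv] at hkk'
  exact (dualEquiv L).injective (Subtype.val_injective hkk')

omit [MeasurableSpace E] [BorelSpace E] in
/-- The dual vectors pair integrally with the lattice. [folklore] -/
theorem inner_dualVec_of_mem (k : Fin (finrank ℝ E) → ℤ) {ℓ : E} (hℓ : ℓ ∈ L) :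
    ∃ N : ℤ, ⟪dualVec L k, ℓ⟫ = N := by
  rw [inner_dualVec]
  choose f hf using fun i ↦ rBasis_repr_of_mem L hℓ i
  exact ⟨∑ i, k i * f i, by push_cast; exact Finset.sum_congr rfl fun i _ ↦ by rw [hf i]⟩

omit [MeasurableSpace E] [BorelSpace E] in
/-- Shells of dual vectors are finite. [folklore] -/
theorem finite_norm_dualVec_le (R : ℝ) : {k : Fin (finrank ℝ E) → ℤ | ‖dualVec L k‖ ≤ R}.Finite := by
  have h : (Metric.closedBall (0 : E) R ∩ span ℤ (Set.range (dualRBasis L))).Finite :=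
    ZSpan.setFinite_inter _ Metric.isBounded_closedBall
  have h' : {v : span ℤ (Set.range (dualRBasis L)) | ‖(v : E)‖ ≤ R}.Finite := by
    refine (h.preimage Subtype.val_injective.injOn).subset fun v hv => ?_
    exact ⟨mem_closedBall_zero_iff.2 hv, v.2⟩
  refine (h'.preimage_embedding (dualEquiv L).toEmbedding).subset fun k hk => ?_
  change ‖((dualEquiv L k : span ℤ (Set.range (dualRBasis L))) : E)‖ ≤ R
  rwa [coe_dualEquiv]

omit [MeasurableSpace E] [BorelSpace E] in
/-- `∑ₖ exp (-c ‖dualVec L k‖) < ∞` for `c > 0`. [folklore] -/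
theorem summable_exp_neg_mul_norm_dualVec {c : ℝ} (hc : 0 < c) :
    Summable fun k : Fin (finrank ℝ E) → ℤ => Real.exp (-c * ‖dualVec L k‖) := by
  set Λ : Submodule ℤ E := span ℤ (Set.range (dualRBasis L)) with hΛ
  set m : ℕ := finrank ℤ Λ + 1 with hm
  have hr : (-(m : ℝ)) < -(finrank ℤ Λ : ℝ) := by rw [hm]; push_cast; linarith
  have hΛs : Summable fun v : Λ => ‖v‖ ^ (-(m : ℝ)) := ZLattice.summable_norm_rpow Λ _ hr
  -- `exp (-c t) ≤ (m! / c^m) t^{-m}` for `t > 0`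
  have key : ∀ v : Λ, v ≠ 0 →
      Real.exp (-c * ‖v‖) ≤ (m.factorial / c ^ m) * ‖v‖ ^ (-(m : ℝ)) := by
    intro v hv
    have ht : 0 < ‖v‖ := norm_pos_iff.2 hv
    rw [Real.rpow_neg (norm_nonneg _), Real.rpow_natCast, neg_mul, Real.exp_neg]
    have h1 := Real.pow_div_factorial_le_exp (c * ‖v‖) (by positivity) m
    have h2 : 0 < (c * ‖v‖) ^ m / m.factorial := by positivity
    calc (Real.exp (c * ‖v‖))⁻¹ ≤ ((c * ‖v‖) ^ m / m.factorial)⁻¹ := inv_anti₀ h2 h1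
      _ = m.factorial / c ^ m * (‖v‖ ^ m)⁻¹ := by
        rw [inv_div, mul_pow]
        field_simp
  have hexp : Summable fun v : Λ => Real.exp (-c * ‖v‖) := by
    refine Summable.of_norm_bounded_eventually (hΛs.mul_left (m.factorial / c ^ m)) ?_
    refine Filter.eventually_cofinite.2 ((Set.finite_singleton (0 : Λ)).subset fun v hv => ?_)
    rw [Set.mem_singleton_iff]
    by_contra hv0
    refine hv ?_
    rw [Real.norm_eq_abs, Real.abs_exp]
    exact key v hv0
  have heq : (fun k : Fin (finrank ℝ E) → ℤ => Real.exp (-c * ‖dualVec L k‖)) =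
      (fun v : Λ => Real.exp (-c * ‖v‖)) ∘ dualEquiv L := by
    funext k
    simp only [Function.comp_apply, Submodule.coe_norm, coe_dualEquiv]
  rw [heq, Equiv.summable_iff]
  exact hexp

/-- The Fourier coefficient integral of the unfolding lemma is the Fourier transform at the dual
vector: `∫ h · echar L (-k) = 𝓕 h (dualVec L k)`. [folklore] -/
theorem integral_mul_echar_neg_eq_fourierIntegral (h : E → ℂ) (k : Fin (finrank ℝ E) → ℤ) :
    ∫ x, h x * echar L (-k) x = 𝓕 h (dualVec L k) := by
  rw [Real.fourier_eq']
  congr 1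
  funext x
  have hx : echar L (-k) x = Complex.exp (↑(-2 * π * ⟪x, dualVec L k⟫) * Complex.I) := by
    rw [echar_eq_cexp_inner_dualVec, dualVec_neg, inner_neg_left, real_inner_comm x (dualVec L k)]
    congr 1
    push_cast
    ring
  rw [hx, smul_eq_mul, mul_comm]

/-! ## Unfolding a normally summable complex periodization -/

/-- **Unfolding with a periodic factor, complex summable version**:
`∫_{fdom} (∑_ℓ h(x+ℓ)) e(x) dx = ∫_E h e` for `h : E → ℂ` continuous and integrable whose lattice
translates are dominated on the fundamental domain by a summable sequence, and `e` continuous,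
bounded and `L`-periodic (as `integral_fdom_periodize_mul_of_summable`, for complex `h`).
[folklore] -/
theorem integral_fdom_tsum_mul_of_summable {h : E → ℂ} (hc : Continuous h) (hint : Integrable h)
    {M : L → ℝ} (hM : Summable M) (hbd : ∀ (ℓ : L) (x : E), x ∈ fdom L → ‖h (x + ℓ)‖ ≤ M ℓ)
    {e : E → ℂ} (he : Continuous e) (hpe : ∀ ℓ ∈ L, ∀ x, e (x + ℓ) = e x) {B : ℝ}
    (heB : ∀ x, ‖e x‖ ≤ B) :
    ∫ x in fdom L, (∑' ℓ : L, h (x + ℓ)) * e x = ∫ x, h x * e x := by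
  have : MeasurableVAdd L E := (inferInstance : MeasurableVAdd L.toAddSubgroup E)
  have : VAddInvariantMeasure L E (volume : Measure E) :=
    (inferInstance : VAddInvariantMeasure L.toAddSubgroup E (volume : Measure E))
  -- `h e` is integrable (integrable times bounded continuous)
  have hint' : Integrable (fun x => h x * e x) :=
    hint.mul_bdd he.aestronglyMeasurable (Eventually.of_forall heB)
  rw [(isAddFundamentalDomain L volume).integral_eq_tsum'' _ hint']
  have hvadd : ∀ (ℓ : L) (x : E), ℓ +ᵥ x = x + (ℓ : E) := fun ℓ x => by
    rw [Submodule.vadd_def, vadd_eq_add, add_comm]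
  simp_rw [hvadd]
  -- periodicity of `e`
  have hpe' : ∀ (ℓ : L) (x : E), e (x + (ℓ : E)) = e x := fun ℓ x => hpe _ ℓ.2 x
  simp_rw [hpe']
  -- each term is integrable on `fdom`
  have hF : ∀ ℓ : L, Integrable (fun x : E => h (x + (ℓ : E)) * e x) (volume.restrict (fdom L)) :=
    fun ℓ => (integrableOn_fdom L volume (by fun_prop) :
      IntegrableOn (fun x : E => h (x + (ℓ : E)) * e x) (fdom L) volume)
  -- the integrals of the norms are summable: `∫_{fdom} ‖h(x+ℓ)‖ ‖e x‖ ≤ M ℓ · B · vol(fdom)`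
  have hnorm : ∀ ℓ : L, ∫ x in fdom L, ‖h (x + (ℓ : E)) * e x‖ ≤ M ℓ * B * volume.real (fdom L) := by
    intro ℓ
    have h1 : ‖∫ x in fdom L, ‖h (x + (ℓ : E)) * e x‖‖ ≤ M ℓ * B * volume.real (fdom L) := by
      refine norm_setIntegral_le_of_norm_le_const (measure_fdom_lt_top L volume) fun x hx => ?_
      rw [norm_norm, norm_mul]
      exact mul_le_mul (hbd ℓ x hx) (heB x) (norm_nonneg _) ((norm_nonneg _).trans (hbd ℓ x hx))
    exact (Real.le_norm_self _).trans h1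
  have hsum : Summable fun ℓ : L => ∫ x in fdom L, ‖h (x + (ℓ : E)) * e x‖ :=
    Summable.of_nonneg_of_le (fun ℓ => integral_nonneg fun x => norm_nonneg _) hnorm
      ((hM.mul_right B).mul_right _)
  rw [integral_tsum_of_summable_integral_norm hF hsum]
  -- pointwise: `(∑_ℓ h(x+ℓ)) · e x = ∑_ℓ h(x+ℓ) e x`
  refine setIntegral_congr_fun (fdom_measurableSet L) fun x _ => ?_
  exact tsum_mul_right.symm

/-- **The Fourier coefficients of a summable periodization are the Fourier transform at the dual
vectors**: `mean (e_{−k} · ∑_ℓ h(· + ℓ)) = (vol fdom)⁻¹ 𝓕 h (dualVec L k)` for `h : E → ℂ`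
continuous, integrable, with normally summable periodization on the fundamental domain.
[cite: Grafakos2014, Thm 3.2.8] -/
theorem mean_echar_mul_tsum_of_summable {h : E → ℂ} (hc : Continuous h) (hint : Integrable h)
    {M : L → ℝ} (hM : Summable M) (hbd : ∀ (ℓ : L) (x : E), x ∈ fdom L → ‖h (x + ℓ)‖ ≤ M ℓ)
    (k : Fin (finrank ℝ E) → ℤ) :
    mean L volume (fun x => echar L (-k) x * ∑' ℓ : L, h (x + ℓ)) =
      (((volume.real (fdom L))⁻¹ : ℝ) : ℂ) * 𝓕 h (dualVec L k) := by
  rw [mean, Complex.real_smul, ← integral_mul_echar_neg_eq_fourierIntegral]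
  congr 1
  rw [← integral_fdom_tsum_mul_of_summable L hc hint hM hbd (continuous_echar L (-k))
    (fun ℓ hℓ x => echar_add_of_mem L (-k) hℓ x) (fun x => (norm_echar L (-k) x).le)]
  exact setIntegral_congr_fun (fdom_measurableSet L) fun x _ => mul_comm _ _

/-! ## Pointwise Poisson summation -/

/-- **Pointwise Poisson summation over a lattice.** Let `h : E → ℂ` be continuous and integrable,
with lattice translates normally summable on a ball containing a neighbourhood of the fundamental
domain (`‖h (x + ℓ)‖ ≤ M ℓ` for `‖x‖ ≤ R`, `∑ M ℓ < ∞`, `‖x‖ + 1 ≤ R` on `fdom L`), and with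
`∑ₖ ‖𝓕 h (dualVec L k)‖ < ∞`. Then for every `x`,
`∑_{ℓ ∈ L} h (x + ℓ) = (vol (fdom L))⁻¹ ∑ₖ 𝓕 h (dualVec L k) · echar L k x`, absolutely convergent.
[cite: Grafakos2014, Thm 3.2.8] -/
theorem hasSum_echar_tsum_of_summable {h : E → ℂ} (hc : Continuous h) (hint : Integrable h)
    {M : L → ℝ} (hM : Summable M) {R : ℝ} (hR : ∀ x ∈ fdom L, ‖x‖ + 1 ≤ R)
    (hbd : ∀ (ℓ : L) (x : E), ‖x‖ ≤ R → ‖h (x + ℓ)‖ ≤ M ℓ)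
    (hF : Summable fun k : Fin (finrank ℝ E) → ℤ => ‖𝓕 h (dualVec L k)‖) (x : E) :
    HasSum (fun k : Fin (finrank ℝ E) → ℤ =>
      (((volume.real (fdom L))⁻¹ : ℝ) : ℂ) * 𝓕 h (dualVec L k) * echar L k x) (∑' ℓ : L, h (x + ℓ)) := by
  -- the periodization `g`
  set g : E → ℂ := fun y => ∑' ℓ : L, h (y + ℓ) with hg
  -- `g` is `L`-periodic
  have hper : ∀ ℓ₀ ∈ L, ∀ y, g (y + ℓ₀) = g y := by
    intro ℓ₀ hℓ₀ y
    simp only [hg]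
    have h1 : (fun ℓ : L => h (y + ℓ₀ + ℓ)) =
        fun ℓ : L => h (y + ((Equiv.addLeft (⟨ℓ₀, hℓ₀⟩ : L) ℓ : L) : E)) := by
      funext ℓ
      simp [add_assoc]
    rw [h1]
    exact (Equiv.addLeft (⟨ℓ₀, hℓ₀⟩ : L)).tsum_eq (fun ℓ : L => h (y + (ℓ : E)))
  -- `g` is continuous on the ball `‖y‖ ≤ R` (normal convergence) ...
  have hball : ContinuousOn g (Metric.closedBall 0 R) := by
    refine continuousOn_tsum (fun ℓ => (hc.comp (continuous_id.add continuous_const)).continuousOn)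
      hM fun ℓ y hy => hbd ℓ y ?_
    rwa [Metric.mem_closedBall, dist_zero_right] at hy
  -- ... hence everywhere, by periodicity (`fdom L + ball 0 1 ⊆ closedBall 0 R`)
  have hcont : Continuous g := by
    refine continuous_iff_continuousAt.2 fun y => ?_
    set x₀ : E := ZSpan.fract (rBasis L) y with hx₀
    have hx₀mem : x₀ ∈ fdom L := ZSpan.fract_mem_fundamentalDomain (rBasis L) y
    have hℓ : y - x₀ ∈ L := by
      have h1 : y - x₀ = (ZSpan.floor (rBasis L) y : E) := by
        rw [hx₀, ZSpan.fract_apply, sub_sub_cancel]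
      rw [h1]
      exact (rBasis_span L).le (ZSpan.floor (rBasis L) y).2
    have hnhds : Metric.closedBall (0 : E) R ∈ 𝓝 x₀ := by
      refine Metric.mem_nhds_iff.2 ⟨1, one_pos, fun z hz => ?_⟩
      rw [Metric.mem_ball, dist_eq_norm] at hz
      rw [Metric.mem_closedBall, dist_zero_right]
      have h1 := norm_sub_norm_le z x₀
      have h2 := hR x₀ hx₀mem
      linarith
    have hAt : ContinuousAt g x₀ := hball.continuousAt hnhds
    have h3 : ContinuousAt (g ∘ fun z => z - (y - x₀)) y :=
      hAt.comp_of_eq (continuousAt_id.sub continuousAt_const) (sub_sub_cancel y x₀)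
    refine h3.congr (Eventually.of_forall fun z => ?_)
    have h4 := hper _ hℓ (z - (y - x₀))
    rw [sub_add_cancel] at h4
    exact h4.symm
  -- the Fourier coefficients of the descent
  have hbd' : ∀ (ℓ : L) (y : E), y ∈ fdom L → ‖h (y + ℓ)‖ ≤ M ℓ :=
    fun ℓ y hy => hbd ℓ y (by linarith [hR y hy])
  have hcoeff : ∀ k : Fin (finrank ℝ E) → ℤ, UnitAddTorus.mFourierCoeff (descend (L := L) g) k =
      (((volume.real (fdom L))⁻¹ : ℝ) : ℂ) * 𝓕 h (dualVec L k) := fun k => by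
    rw [mFourierCoeff_descend volume hper, mean_echar_mul_tsum_of_summable L hc hint hM hbd' k]
  have hsum : Summable (UnitAddTorus.mFourierCoeff (descend (L := L) g)) := by
    refine Summable.of_norm ?_
    simp_rw [hcoeff, norm_mul]
    exact hF.mul_left _
  -- transport of Mathlib's pointwise convergence theorem on the torus
  have hmain := UnitAddTorus.hasSum_mFourier_series_apply_of_summable
    (f := ⟨descend (L := L) g, continuous_descend hcont hper⟩) hsum (toTorus L x)
  simp only [smul_eq_mul, ContinuousMap.coe_mk] at hmain
  rw [descend_toTorus hper] at hmain
  have heq : (fun k : Fin (finrank ℝ E) → ℤ =>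
      UnitAddTorus.mFourierCoeff (descend (L := L) g) k * UnitAddTorus.mFourier k (toTorus L x)) =
      fun k => (((volume.real (fdom L))⁻¹ : ℝ) : ℂ) * 𝓕 h (dualVec L k) * echar L k x := by
    funext k
    rw [hcoeff, echar_eq_mFourier]
  rwa [heq] at hmain

end Literature.Algebra.EuclideanLattices.LatticePeriodic
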